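import Mathlib.Topology.MetricSpace.HausdorffDistance
import Literature.Probability.Percolation.StripCoresPrelim
import HarnessLib

/-!
# The junction squares of the cut

Topic `Probability/Percolation`.  Support file (definitions and proofs, no named fact) for the zone
geometry of the proof of Schramm–Smirnov's Prop. 4.1 (Ann. Probab. 39 (2011), §4), per-strip form:
the CHOICE of the junction squares and of the cut parameters of the cut, i.e. the construction of a
`StripPieces.PathCoreData` from the raw data `CutData` (finitely many paths of bounded variation with
finitely many multiple points, a compact carrier whose frontier meets the cut finitely often).

Order of the choices (`CutData.nonempty_coreChoice`): the junction points `J` (frontier points,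
multiple points, endpoints) receive BIG squares of a common generic radius `r_B` below a prescribed
bound `F_B #J` and below a tenth of their mutual distances and of their distances to the frontier of
the carrier (when off it); the separation `m` of the frontier of the carrier from the cut in fixed
shells around the frontier junction squares and the distance `d_P` of the cut outside the big squares
to the frontier are then positive; the variation bound `η ≤ min (η_max, m / 5)`; the cut parameters
at variation spacing `η`, off the parameters on the boundaries of the big squares; finally SMALL
squares of a common generic radius `r_b` at the cut points inside the carrier and outside the big
squares, below `f_b #small`, a tenth of `r_B`, of their mutual distances, of their distances to the big
squares and to the frontier.  The output `CoreChoice` records the squares and everything the block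
geometry needs: centres on the cut, uniform separation of the closed squares (`sep`), the trichotomy
interior / exterior / frontier-big with margins (`kind`), the shell separation at frontier squares
(`bdry_sep`), the margin of the good points of the cut (`good_far`), and the fields of
`PathCoreData` (`CoreChoice.pathCoreData`).

## References

* O. Schramm, S. Smirnov, Ann. Probab. 39 (2011), arXiv:1101.5820, §4, proof of Prop. 4.1 (the
  points `x_i` and the discs `B(x_i, s)`). [SchrammSmirnov2011]
-/

noncomputable section

open Set Metric Filter Topology
open scoped ENNReal NNReal unitInterval

namespace Literature.Probability.Percolation

namespace StripPieces

/-! ### A finite minimum of positive reals -/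

/-- A positive lower bound for finitely many positive reals. [folklore] -/
theorem exists_pos_le_forall_finset {ι : Type*} (S : Finset ι) (φ : ι → ℝ) (h : ∀ x ∈ S, 0 < φ x) :
    ∃ q > 0, ∀ x ∈ S, q ≤ φ x := by
  by_cases hS : S.Nonempty
  · obtain ⟨x₀, hx₀, hmin⟩ := S.exists_min_image φ hS
    exact ⟨φ x₀, h x₀ hx₀, hmin⟩
  · exact ⟨1, one_pos, fun x hx => absurd ⟨x, hx⟩ hS⟩

/-! ### The raw data of the cut -/

/-- **The raw data**: finitely many paths of bounded variation with finitely many multiple points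
(`IsFiniteLengthPathUnion`), and a nonempty compact carrier whose frontier meets the cut at finitely
many points. [cite: SchrammSmirnov2011, Thm. 1.7 (hypothesis on α) and §2 ("α intersects ∂Q₀ at finitely many points")] -/
structure CutData where
  /-- number of paths -/
  n : ℕ
  /-- the paths -/
  γ : Fin n → C(I, ℂ)
  bv : ∀ i, BoundedVariationOn (γ i) univ
  fin_mult : {z : ℂ | ∃ p q : Fin n × I, p ≠ q ∧ γ p.1 p.2 = z ∧ γ q.1 q.2 = z}.Finite
  /-- the carrier -/
  Qc : Set ℂ
  Qc_cpt : IsCompact Qc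
  Qc_ne : Qc.Nonempty
  fin_frontier : ((⋃ i, range (γ i)) ∩ frontier Qc).Finite

namespace CutData

variable (𝔇 : CutData)

/-- The cut. [folklore] -/
def cut : Set ℂ := ⋃ i, range (𝔇.γ i)

/-- The paths extended constantly to the line. [folklore] -/
def γe (i : Fin 𝔇.n) : ℝ → ℂ := fun t => 𝔇.γ i (projIcc 0 1 zero_le_one t)

/-- **The junction points**: frontier points, multiple points and endpoints of the cut.
[cite: SchrammSmirnov2011, §4, proof of Prop. 4.1 (the points x_i)] -/
def J : Set ℂ :=
  (𝔇.cut ∩ frontier 𝔇.Qc ∪ {z : ℂ | ∃ p q : Fin 𝔇.n × I, p ≠ q ∧ 𝔇.γ p.1 p.2 = z ∧ 𝔇.γ q.1 q.2 = z}) ∪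
    ⋃ i, {𝔇.γ i 0, 𝔇.γ i 1}

variable {𝔇}

/-- `γe_continuous` (γe continuous). [folklore] -/
theorem γe_continuous (i : Fin 𝔇.n) : Continuous (𝔇.γe i) := (𝔇.γ i).continuous.comp continuous_projIcc

/-- `γe_of_mem` (γe of mem). [folklore] -/
theorem γe_of_mem (i : Fin 𝔇.n) {t : ℝ} (ht : t ∈ Icc (0 : ℝ) 1) : 𝔇.γe i t = 𝔇.γ i ⟨t, ht⟩ := by
  simp [γe, projIcc_of_mem _ ht]

/-- The extended paths have bounded variation on `[0, 1]`. [folklore] -/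
theorem γe_bv (i : Fin 𝔇.n) : BoundedVariationOn (𝔇.γe i) (Icc 0 1) := by
  have h := eVariationOn.comp_eq_of_monotoneOn (𝔇.γ i) (t := Icc (0 : ℝ) 1) (projIcc 0 1 zero_le_one)
    ((monotone_projIcc zero_le_one).monotoneOn _)
  have himg : projIcc (0 : ℝ) 1 zero_le_one '' Icc 0 1 = univ :=
    eq_univ_of_forall fun x => ⟨x, x.2, projIcc_val zero_le_one x⟩
  rw [himg] at h
  show eVariationOn _ _ ≠ ⊤
  rw [show 𝔇.γe i = 𝔇.γ i ∘ projIcc 0 1 zero_le_one from rfl, h]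
  exact 𝔇.bv i

/-- Points of the extended paths are points of the cut. [folklore] -/
theorem γe_mem_cut (i : Fin 𝔇.n) (t : ℝ) : 𝔇.γe i t ∈ 𝔇.cut := mem_iUnion.2 ⟨i, _, rfl⟩

/-- Points of the cut are values of the extended paths on `[0, 1]`. [folklore] -/
theorem exists_γe_eq_of_mem_cut {z : ℂ} (hz : z ∈ 𝔇.cut) : ∃ i, ∃ t ∈ Icc (0 : ℝ) 1, 𝔇.γe i t = z := by
  obtain ⟨i, u, rfl⟩ := mem_iUnion.1 hz
  exact ⟨i, u, u.2, by simp [γe, projIcc_val]⟩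

/-- The cut is compact. [folklore] -/
theorem isCompact_cut : IsCompact 𝔇.cut := isCompact_iUnion fun i => isCompact_range (𝔇.γ i).continuous

/-- The frontier of the carrier is compact. [folklore] -/
theorem isCompact_frontier : IsCompact (frontier 𝔇.Qc) :=
  𝔇.Qc_cpt.of_isClosed_subset isClosed_frontier 𝔇.Qc_cpt.isClosed.frontier_subset

/-- The junction points lie on the cut. [folklore] -/
theorem J_subset_cut : 𝔇.J ⊆ 𝔇.cut := by
  rintro z ((⟨hz, -⟩ | ⟨p, q, -, hp, -⟩) | hz)
  · exact hz
  · exact hp ▸ mem_iUnion.2 ⟨p.1, p.2, rfl⟩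
  · obtain ⟨i, hi⟩ := mem_iUnion.1 hz
    rcases hi with rfl | rfl
    · exact mem_iUnion.2 ⟨i, 0, rfl⟩
    · exact mem_iUnion.2 ⟨i, 1, rfl⟩

/-- The junction points are finitely many. [folklore] -/
theorem J_finite : 𝔇.J.Finite :=
  ((𝔇.fin_frontier.union 𝔇.fin_mult).union (finite_iUnion fun _ => (finite_singleton _).insert _))

/-- Multiple points are junction points. [folklore] -/
theorem mem_J_of_multiple {k k' : Fin 𝔇.n} {t t' : ℝ} (ht : t ∈ Icc (0 : ℝ) 1) (ht' : t' ∈ Icc (0 : ℝ) 1)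
    (hne : k ≠ k' ∨ t ≠ t') (heq : 𝔇.γe k t = 𝔇.γe k' t') : 𝔇.γe k t ∈ 𝔇.J := by
  refine Or.inl (Or.inr ⟨(k, ⟨t, ht⟩), (k', ⟨t', ht'⟩), ?_, (γe_of_mem k ht).symm, ?_⟩)
  · intro h
    simp only [Prod.mk.injEq, Subtype.mk.injEq] at h
    rcases hne with hne | hne
    · exact hne h.1
    · exact hne h.2
  · rw [heq, γe_of_mem k' ht']

/-- Frontier points of the cut are junction points. [folklore] -/
theorem mem_J_of_frontier {z : ℂ} (hz : z ∈ 𝔇.cut) (hfr : z ∈ frontier 𝔇.Qc) : z ∈ 𝔇.J :=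
  Or.inl (Or.inl ⟨hz, hfr⟩)

/-- Endpoints are junction points. [folklore] -/
theorem γe_zero_mem_J (i : Fin 𝔇.n) : 𝔇.γe i 0 ∈ 𝔇.J := by
  refine Or.inr (mem_iUnion.2 ⟨i, Or.inl ?_⟩)
  rw [γe_of_mem i ⟨le_rfl, zero_le_one⟩]; rfl

/-- Endpoints are junction points. [folklore] -/
theorem γe_one_mem_J (i : Fin 𝔇.n) : 𝔇.γe i 1 ∈ 𝔇.J := by
  refine Or.inr (mem_iUnion.2 ⟨i, Or.inr ?_⟩)
  rw [γe_of_mem i ⟨zero_le_one, le_rfl⟩]; rfl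

end CutData

/-! ### The choice of the squares -/

/-- **A choice of junction squares and cut parameters** for the cut data `𝔇`, within the bounds
`F_B` (radius of the big squares given their number), `η_max` (variation bound) and `f_b` (radius of
the small squares given their number).  Big squares: indices `Fin.castAdd nb i`; small squares:
indices `Fin.natAdd nB j`. [cite: SchrammSmirnov2011, §4, proof of Prop. 4.1 (the discs B(x_i, s))] -/
structure CoreChoice (𝔇 : CutData) (FB : ℕ → ℝ) (ηmax : ℝ) (fb : ℕ → ℝ) where
  /-- number of big squares -/
  nB : ℕ
  /-- number of small squares -/
  nb : ℕ
  /-- centres -/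
  ctr : Fin (nB + nb) → ℂ
  /-- half-widths -/
  rad : Fin (nB + nb) → ℝ
  /-- the big radius -/
  rB : ℝ
  /-- the small radius -/
  rb : ℝ
  /-- the variation bound -/
  η : ℝ
  /-- the margin -/
  d₀ : ℝ
  /-- the cut parameters -/
  CUT : Fin 𝔇.n → Finset ℝ
  rad_big : ∀ i, rad (Fin.castAdd nb i) = rB
  rad_small : ∀ j, rad (Fin.natAdd nB j) = rb
  rB_pos : 0 < rB
  rB_le : rB ≤ FB nB
  rb_pos : 0 < rb
  rb_le : rb ≤ fb nb
  rb_le_rB : rb ≤ rB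
  η_pos : 0 < η
  η_le : η ≤ ηmax
  d₀_pos : 0 < d₀
  /-- centres lie on the cut -/
  ctr_mem : ∀ c, ctr c ∈ 𝔇.cut
  /-- the closed squares are uniformly separated -/
  sep : ∀ c c', c ≠ c' → ∀ w ∈ coreSqCl (ctr c) (rad c), ∀ w' ∈ coreSqCl (ctr c') (rad c'), 8 * rb ≤ dist w w'
  /-- interior / exterior / frontier-big trichotomy, with margins -/
  kind : ∀ c, (∀ w ∈ coreSqCl (ctr c) (rad c), w ∈ interior 𝔇.Qc ∧ ∀ z ∈ frontier 𝔇.Qc, d₀ ≤ dist w z) ∨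
    (∀ w ∈ coreSqCl (ctr c) (rad c), w ∉ 𝔇.Qc ∧ ∀ z ∈ 𝔇.Qc, d₀ ≤ dist w z) ∨
    ((∃ i, c = Fin.castAdd nb i) ∧ ctr c ∈ frontier 𝔇.Qc)
  /-- at a frontier square, the frontier of the carrier and the cut are separated in the shells -/
  bdry_sep : ∀ c, ctr c ∈ frontier 𝔇.Qc → ∀ z ∈ frontier 𝔇.Qc, rad c / 2 ≤ supDist z (ctr c) →
    supDist z (ctr c) ≤ 3 * rad c / 2 → ∀ a ∈ 𝔇.cut ∩ 𝔇.Qc, rad c ≤ supDist a (ctr c) →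
    supDist a (ctr c) ≤ 3 * rad c / 2 → 5 * η ≤ dist z a
  /-- good points of the cut are far from the frontier -/
  good_far : ∀ a ∈ 𝔇.cut ∩ 𝔇.Qc, (∀ c, a ∉ coreSq (ctr c) (rad c)) → ∀ z ∈ frontier 𝔇.Qc, d₀ ≤ dist a z
  cut_bad : ∀ k, ∀ t ∈ CUT k, 𝔇.γe k t ∈ 𝔇.Qc → ∃ c, 𝔇.γe k t ∈ coreSq (ctr c) (rad c)
  cut_zero : ∀ k, (0 : ℝ) ∈ CUT k
  cut_one : ∀ k, (1 : ℝ) ∈ CUT k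
  cut_mem : ∀ k, ∀ t ∈ CUT k, t ∈ Icc (0 : ℝ) 1
  cut_var : ∀ k, ∀ s ∈ CUT k, ∀ t ∈ CUT k, s < t → (∀ u ∈ CUT k, ¬ (s < u ∧ u < t)) →
    eVariationOn (𝔇.γe k) (Icc s t) ≤ ENNReal.ofReal η
  fin_frontier_K : ∀ k c, {t : ℝ | t ∈ Icc (0 : ℝ) 1 ∧ 𝔇.γe k t ∈ frontier (coreSq (ctr c) (rad c))}.Finite
  frontier_Q_core : ∀ k, ∀ t ∈ Icc (0 : ℝ) 1, 𝔇.γe k t ∈ frontier 𝔇.Qc → ∃ c, 𝔇.γe k t ∈ coreSq (ctr c) (rad c)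
  multiple : ∀ k k' t t', t ∈ Icc (0 : ℝ) 1 → t' ∈ Icc (0 : ℝ) 1 → (k ≠ k' ∨ t ≠ t') → 𝔇.γe k t = 𝔇.γe k' t' →
    ∃ c, 𝔇.γe k t ∈ coreSq (ctr c) (rad c)

namespace CoreChoice

variable {𝔇 : CutData} {FB : ℕ → ℝ} {ηmax : ℝ} {fb : ℕ → ℝ} (𝔠 : CoreChoice 𝔇 FB ηmax fb)

/-- **The path-and-squares data** of the choice. [folklore] -/
def pathCoreData : PathCoreData where
  n := 𝔇.n
  γ := 𝔇.γe
  γ_cont := CutData.γe_continuous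
  γ_bv := CutData.γe_bv
  Qc := 𝔇.Qc
  Qc_closed := 𝔇.Qc_cpt.isClosed
  M := 𝔠.nB + 𝔠.nb
  ctr := 𝔠.ctr
  rad := 𝔠.rad
  η := 𝔠.η
  CUT := 𝔠.CUT
  cut_bad := 𝔠.cut_bad
  cut_zero := 𝔠.cut_zero
  cut_one := 𝔠.cut_one
  cut_var := 𝔠.cut_var
  fin_frontier_K := 𝔠.fin_frontier_K
  frontier_Q_core := 𝔠.frontier_Q_core
  multiple := 𝔠.multiple

/-- Every radius is the big or the small one. [folklore] -/
theorem rad_eq (c : Fin (𝔠.nB + 𝔠.nb)) : 𝔠.rad c = 𝔠.rB ∨ 𝔠.rad c = 𝔠.rb := by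
  induction c using Fin.addCases with
  | left i => exact Or.inl (𝔠.rad_big i)
  | right j => exact Or.inr (𝔠.rad_small j)

/-- `rad_pos` (rad pos). [folklore] -/
theorem rad_pos (c : Fin (𝔠.nB + 𝔠.nb)) : 0 < 𝔠.rad c := by
  rcases 𝔠.rad_eq c with h | h
  · rw [h]; exact 𝔠.rB_pos
  · rw [h]; exact 𝔠.rb_pos

/-- `rad_le_rB` (rad le rB). [folklore] -/
theorem rad_le_rB (c : Fin (𝔠.nB + 𝔠.nb)) : 𝔠.rad c ≤ 𝔠.rB := by
  rcases 𝔠.rad_eq c with h | h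
  · rw [h]
  · rw [h]; exact 𝔠.rb_le_rB

/-- `rb_le_rad` (rb le rad). [folklore] -/
theorem rb_le_rad (c : Fin (𝔠.nB + 𝔠.nb)) : 𝔠.rb ≤ 𝔠.rad c := by
  rcases 𝔠.rad_eq c with h | h
  · rw [h]; exact 𝔠.rb_le_rB
  · rw [h]

/-- The centre lies in its open square. [folklore] -/
theorem ctr_mem_coreSq (c : Fin (𝔠.nB + 𝔠.nb)) : 𝔠.ctr c ∈ coreSq (𝔠.ctr c) (𝔠.rad c) :=
  self_mem_coreSq (𝔠.rad_pos c)

/-- Every point of a closed square is within `2 r_B` of the cut. [folklore] -/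
theorem exists_mem_cut_dist_le {c : Fin (𝔠.nB + 𝔠.nb)} {w : ℂ} (hw : w ∈ coreSqCl (𝔠.ctr c) (𝔠.rad c)) :
    ∃ a ∈ 𝔇.cut, dist w a ≤ 2 * 𝔠.rB :=
  ⟨𝔠.ctr c, 𝔠.ctr_mem c, (dist_le_of_mem_coreSqCl hw).trans (by have := 𝔠.rad_le_rB c; linarith)⟩

end CoreChoice

/-! ### Existence of a choice -/

namespace CutData

variable (𝔇 : CutData)

/-- **The junction squares and the cut parameters can be chosen** within any positive bounds.
[cite: SchrammSmirnov2011, §4, proof of Prop. 4.1 (the discs B(x_i, s), "approximating if necessary"; formalisation device for the per-strip coarse graining)] -/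
theorem nonempty_coreChoice {FB : ℕ → ℝ} (hFB : ∀ m, 0 < FB m) {ηmax : ℝ} (hηmax : 0 < ηmax) {fb : ℕ → ℝ}
    (hfb : ∀ m, 0 < fb m) : Nonempty (CoreChoice 𝔇 FB ηmax fb) := by
  classical
  -- the junction points
  set JF : Finset ℂ := J_finite (𝔇 := 𝔇) |>.toFinset with hJF
  have hJF_iff : ∀ z, z ∈ JF ↔ z ∈ 𝔇.J := fun z => by rw [hJF, Finite.mem_toFinset]
  have hJcut : ∀ z ∈ JF, z ∈ 𝔇.cut := fun z hz => J_subset_cut ((hJF_iff z).1 hz)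
  have hQcl : IsClosed 𝔇.Qc := 𝔇.Qc_cpt.isClosed
  have hQne : 𝔇.Qcᶜ.Nonempty := nonempty_compl.2 𝔇.Qc_cpt.ne_univ
  -- STEP 1: the big radius
  obtain ⟨gJ, hgJ, hsepJ⟩ := exists_pos_le_dist_finset JF
  -- margin to the frontier for the junction points off the frontier
  set φ : ℂ → ℝ := fun x => if x ∈ frontier 𝔇.Qc then 1 else
    if x ∈ 𝔇.Qc then infDist x 𝔇.Qcᶜ / 4 else infDist x 𝔇.Qc / 4 with hφ
  have hφpos : ∀ x ∈ JF, 0 < φ x := by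
    intro x _
    by_cases hfr : x ∈ frontier 𝔇.Qc
    · simp [hφ, hfr]
    by_cases hQ : x ∈ 𝔇.Qc
    · simp only [hφ, hfr, hQ, if_false, if_true]
      have hint : x ∈ interior 𝔇.Qc := by rw [← self_sdiff_frontier]; exact ⟨hQ, hfr⟩
      have : x ∉ closure 𝔇.Qcᶜ := by rw [closure_compl]; exact fun h => h hint
      have h := (isClosed_closure.notMem_iff_infDist_pos hQne.closure).1 this
      rw [infDist_closure] at h
      linarith
    · simp only [hφ, hfr, hQ, if_false]
      have h := (hQcl.notMem_iff_infDist_pos 𝔇.Qc_ne).1 hQ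
      linarith
  obtain ⟨q₃, hq₃, hq₃le⟩ := exists_pos_le_forall_finset JF φ hφpos
  set rBmax : ℝ := min (FB JF.card) (min (gJ / 10) q₃) with hrBmax
  have hrBmax_pos : 0 < rBmax := lt_min (hFB _) (lt_min (by positivity) hq₃)
  obtain ⟨rB, hrB, hrBlt, hlevB⟩ := exists_radius_finite_levelSets 𝔇.γe γe_continuous γe_bv JF hrBmax_pos
  have hrB_FB : rB ≤ FB JF.card := hrBlt.le.trans (min_le_left _ _)
  have hrB_gJ : 10 * rB ≤ gJ := by
    have := hrBlt.le.trans ((min_le_right _ _).trans (min_le_left _ _)); linarith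
  have hrB_φ : ∀ x ∈ JF, 4 * rB ≤ 4 * φ x := fun x hx =>
    by have := hrBlt.le.trans ((min_le_right _ _).trans (min_le_right _ _)); nlinarith [hq₃le x hx]
  -- consequences for the big squares
  have bigsep : ∀ x ∈ JF, ∀ x' ∈ JF, x ≠ x' → ∀ w ∈ coreSqCl x rB, ∀ w' ∈ coreSqCl x' rB, 6 * rB ≤ dist w w' := by
    intro x hx x' hx' hne w hw w' hw'
    have h1 := hsepJ x hx x' hx' hne
    have h2 := dist_le_of_mem_coreSqCl hw
    have h3 := dist_le_of_mem_coreSqCl hw'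
    have := dist_triangle x w x'
    have := dist_triangle w w' x'
    rw [dist_comm] at h2
    linarith
  have bigint : ∀ x ∈ JF, x ∉ frontier 𝔇.Qc → x ∈ 𝔇.Qc → ∀ w ∈ coreSqCl x rB,
      w ∈ interior 𝔇.Qc ∧ ∀ z ∈ frontier 𝔇.Qc, 2 * rB ≤ dist w z := by
    intro x hx hfr hQ w hw
    have hφx : 4 * rB ≤ infDist x 𝔇.Qcᶜ := by
      have := hrB_φ x hx; simp only [hφ, hfr, hQ, if_false, if_true] at this; linarith
    have hwx := dist_le_of_mem_coreSqCl hw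
    constructor
    · by_contra hni
      have hcl : w ∈ closure 𝔇.Qcᶜ := by rw [closure_compl]; exact hni
      have := infDist_le_dist_of_mem (x := x) hcl
      rw [infDist_closure, dist_comm] at this
      linarith
    · intro z hz
      have hzc : z ∈ closure 𝔇.Qcᶜ := by
        have h := hz; rw [frontier_eq_closure_inter_closure] at h; exact h.2
      have h1 := infDist_le_dist_of_mem (x := x) hzc
      rw [infDist_closure] at h1
      have := dist_triangle x w z
      rw [dist_comm x w] at this
      linarith
  have bigext : ∀ x ∈ JF, x ∉ frontier 𝔇.Qc → x ∉ 𝔇.Qc → ∀ w ∈ coreSqCl x rB,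
      w ∉ 𝔇.Qc ∧ ∀ z ∈ 𝔇.Qc, 2 * rB ≤ dist w z := by
    intro x hx hfr hQ w hw
    have hφx : 4 * rB ≤ infDist x 𝔇.Qc := by
      have := hrB_φ x hx; simp only [hφ, hfr, hQ, if_false] at this; linarith
    have hwx := dist_le_of_mem_coreSqCl hw
    constructor
    · intro hwQ
      have := infDist_le_dist_of_mem (x := x) hwQ
      rw [dist_comm] at this; linarith
    · intro z hz
      have h1 := infDist_le_dist_of_mem (x := x) hz
      have := dist_triangle x w z
      rw [dist_comm x w] at this
      linarith
  -- STEP 2: the shell separation `m` and the margin `dP`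
  have hαQ : IsCompact (𝔇.cut ∩ 𝔇.Qc) := isCompact_cut.inter_right hQcl
  have shell : ∀ x ∈ JF, ∃ mx > 0, ∀ z ∈ frontier 𝔇.Qc, rB / 2 ≤ supDist z x → supDist z x ≤ 3 * rB / 2 →
      ∀ a ∈ 𝔇.cut ∩ 𝔇.Qc, rB ≤ supDist a x → supDist a x ≤ 3 * rB / 2 → mx ≤ dist z a := by
    intro x hx
    set Z : Set ℂ := frontier 𝔇.Qc ∩ {w | rB / 2 ≤ supDist w x ∧ supDist w x ≤ 3 * rB / 2} with hZ
    set A : Set ℂ := (𝔇.cut ∩ 𝔇.Qc) ∩ {w | rB ≤ supDist w x ∧ supDist w x ≤ 3 * rB / 2} with hA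
    have hshell_closed : ∀ a b : ℝ, IsClosed {w : ℂ | a ≤ supDist w x ∧ supDist w x ≤ b} := fun a b =>
      (isClosed_le continuous_const (continuous_supDist x)).inter (isClosed_le (continuous_supDist x) continuous_const)
    have hZc : IsCompact Z := isCompact_frontier.inter_right (hshell_closed _ _)
    have hAcl : IsClosed A := (hαQ.isClosed).inter (hshell_closed _ _)
    have hdisj : Disjoint Z A := by
      rw [Set.disjoint_left]
      rintro w ⟨hwfr, hw1, -⟩ ⟨⟨hwcut, -⟩, -, hw2⟩
      have hwJ : w ∈ JF := (hJF_iff w).2 (mem_J_of_frontier hwcut hwfr)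
      have hne : x ≠ w := by
        rintro rfl; rw [supDist_self] at hw1; linarith
      have h1 := hsepJ x hx w hwJ hne
      have h2 := dist_le_two_mul_supDist w x
      rw [dist_comm] at h2
      linarith
    obtain ⟨mx, hmx, hfar⟩ := exists_pos_le_dist_of_disjoint hZc hAcl hdisj
    exact ⟨mx, hmx, fun z hz h1 h2 a ha h3 h4 => hfar z ⟨hz, h1, h2⟩ a ⟨ha, h3, h4⟩⟩
  choose! mx hmx hshell using shell
  obtain ⟨m, hm, hmle⟩ := exists_pos_le_forall_finset JF mx hmx
  -- the good points outside the big squares are far from the frontier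
  have far : ∃ dP > 0, ∀ a ∈ 𝔇.cut ∩ 𝔇.Qc, (∀ x ∈ JF, a ∉ coreSq x rB) → ∀ z ∈ frontier 𝔇.Qc, dP ≤ dist a z := by
    set A : Set ℂ := (𝔇.cut ∩ 𝔇.Qc) ∩ ⋂ x ∈ JF, (coreSq x rB)ᶜ with hA
    have hAc : IsCompact A := hαQ.inter_right (isClosed_biInter fun x _ => (isOpen_coreSq x rB).isClosed_compl)
    have hdisj : Disjoint A (frontier 𝔇.Qc) := by
      rw [Set.disjoint_left]
      rintro a ⟨⟨hacut, -⟩, hall⟩ hafr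
      have haJ : a ∈ JF := (hJF_iff a).2 (mem_J_of_frontier hacut hafr)
      exact (mem_iInter₂.1 hall a haJ) (self_mem_coreSq hrB)
    obtain ⟨dP, hdP, hfar⟩ := exists_pos_le_dist_of_disjoint hAc isClosed_frontier hdisj
    exact ⟨dP, hdP, fun a ha hout z hz => hfar a ⟨ha, mem_iInter₂.2 fun x hx => hout x hx⟩ z hz⟩
  obtain ⟨dP, hdP, hfarP⟩ := far
  -- STEP 3: the variation bound
  set η : ℝ := min ηmax (m / 5) with hη
  have hηpos : 0 < η := lt_min hηmax (by positivity)
  have hη5 : 5 * η ≤ m := by have := min_le_right ηmax (m / 5); linarith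
  -- STEP 4: the cut parameters, off the boundaries of the big squares
  have hΦfin : ∀ k, {t : ℝ | t ∈ Icc (0 : ℝ) 1 ∧ ∃ x ∈ JF, supDist (𝔇.γe k t) x = rB}.Finite := by
    intro k
    have : {t : ℝ | t ∈ Icc (0 : ℝ) 1 ∧ ∃ x ∈ JF, supDist (𝔇.γe k t) x = rB} =
        ⋃ x ∈ JF, {t : ℝ | t ∈ Icc (0 : ℝ) 1 ∧ supDist (𝔇.γe k t) x = rB} := by
      ext t; simp only [mem_setOf_eq, mem_iUnion, exists_prop]; tauto
    rw [this]
    exact JF.finite_toSet.biUnion fun x hx => hlevB k x hx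
  choose CUT hCUT0 hCUT1 hCUTmem hCUTΦ hCUTvar using fun k =>
    exists_cut_params (γe_continuous k) (γe_bv k) hηpos (hΦfin k)
  -- STEP 5: the small centres
  set Y : Finset ℂ := (Finset.univ : Finset (Fin 𝔇.n)).biUnion fun k =>
    ((CUT k).filter fun t => 𝔇.γe k t ∈ 𝔇.Qc ∧ ∀ x ∈ JF, 𝔇.γe k t ∉ coreSq x rB).image (𝔇.γe k) with hY
  have hY_iff : ∀ y, y ∈ Y ↔ ∃ k, ∃ t ∈ CUT k, 𝔇.γe k t ∈ 𝔇.Qc ∧ (∀ x ∈ JF, 𝔇.γe k t ∉ coreSq x rB) ∧ 𝔇.γe k t = y := by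
    intro y
    simp only [hY, Finset.mem_biUnion, Finset.mem_univ, true_and, Finset.mem_image, Finset.mem_filter]
    constructor
    · rintro ⟨k, t, ⟨ht, hQ, hout⟩, rfl⟩; exact ⟨k, t, ht, hQ, hout, rfl⟩
    · rintro ⟨k, t, ht, hQ, hout, rfl⟩; exact ⟨k, t, ⟨ht, hQ, hout⟩, rfl⟩
  have hYcut : ∀ y ∈ Y, y ∈ 𝔇.cut := fun y hy => by
    obtain ⟨k, t, -, -, -, rfl⟩ := (hY_iff y).1 hy; exact γe_mem_cut k t
  have hYQ : ∀ y ∈ Y, y ∈ 𝔇.Qc := fun y hy => by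
    obtain ⟨k, t, -, hQ, -, rfl⟩ := (hY_iff y).1 hy; exact hQ
  have hYJ : ∀ y ∈ Y, y ∉ JF := fun y hy hyJ => by
    obtain ⟨k, t, -, -, hout, rfl⟩ := (hY_iff y).1 hy
    exact hout _ hyJ (self_mem_coreSq hrB)
  have hYfr : ∀ y ∈ Y, y ∉ frontier 𝔇.Qc := fun y hy hfr =>
    hYJ y hy ((hJF_iff y).2 (mem_J_of_frontier (hYcut y hy) hfr))
  have hYint : ∀ y ∈ Y, y ∈ interior 𝔇.Qc := fun y hy => by
    rw [← self_sdiff_frontier]; exact ⟨hYQ y hy, hYfr y hy⟩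
  have hYout : ∀ y ∈ Y, ∀ x ∈ JF, rB < supDist y x := by
    intro y hy x hx
    obtain ⟨k, t, ht, -, hout, rfl⟩ := (hY_iff y).1 hy
    have hne : supDist (𝔇.γe k t) x ≠ rB := by
      have ht0 : t ≠ 0 := by
        rintro rfl; exact hYJ _ hy ((hJF_iff _).2 (γe_zero_mem_J k))
      have ht1 : t ≠ 1 := by
        rintro rfl; exact hYJ _ hy ((hJF_iff _).2 (γe_one_mem_J k))
      intro h
      exact hCUTΦ k t ht ht0 ht1 ⟨hCUTmem k t ht, x, hx, h⟩
    have hge : ¬ supDist (𝔇.γe k t) x < rB := fun h => hout x hx (mem_coreSq_iff.2 h)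
    exact lt_of_le_of_ne (not_lt.1 hge) (Ne.symm hne)
  -- STEP 6: the small radius
  obtain ⟨gY, hgY, hsepY⟩ := exists_pos_le_dist_finset Y
  obtain ⟨q₄, hq₄, hq₄le⟩ := exists_pos_le_forall_finset (Y ×ˢ JF) (fun p => supDist p.1 p.2 - rB) fun p hp => by
    obtain ⟨hy, hx⟩ := Finset.mem_product.1 hp
    have := hYout p.1 hy p.2 hx; linarith
  obtain ⟨q₅, hq₅, hq₅le⟩ := exists_pos_le_forall_finset Y (fun y => infDist y 𝔇.Qcᶜ) fun y hy => by
    have : y ∉ closure 𝔇.Qcᶜ := by rw [closure_compl]; exact fun h => h (hYint y hy)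
    have h := (isClosed_closure.notMem_iff_infDist_pos hQne.closure).1 this
    rwa [infDist_closure] at h
  set rbmax : ℝ := min (fb Y.card) (min (rB / 10) (min (gY / 20) (min (q₄ / 10) (q₅ / 4)))) with hrbmax
  have hrbmax_pos : 0 < rbmax := lt_min (hfb _) (lt_min (by positivity) (lt_min (by positivity)
    (lt_min (by positivity) (by positivity))))
  obtain ⟨rb, hrb, hrblt, hlevb⟩ := exists_radius_finite_levelSets 𝔇.γe γe_continuous γe_bv Y hrbmax_pos
  have hrb_fb : rb ≤ fb Y.card := hrblt.le.trans (min_le_left _ _)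
  have hrb2 := hrblt.le.trans (min_le_right _ _)
  have hrb_rB : 10 * rb ≤ rB := by have := hrb2.trans (min_le_left _ _); linarith
  have hrb3 := hrb2.trans (min_le_right _ _)
  have hrb_gY : 20 * rb ≤ gY := by have := hrb3.trans (min_le_left _ _); linarith
  have hrb4 := hrb3.trans (min_le_right _ _)
  have hrb_q₄ : 10 * rb ≤ q₄ := by have := hrb4.trans (min_le_left _ _); linarith
  have hrb_q₅ : 4 * rb ≤ q₅ := by have := hrb4.trans (min_le_right _ _); linarith
  -- consequences for the small squares
  have smallint : ∀ y ∈ Y, ∀ w ∈ coreSqCl y rb, w ∈ interior 𝔇.Qc ∧ ∀ z ∈ frontier 𝔇.Qc, 2 * rb ≤ dist w z := by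
    intro y hy w hw
    have hφy : 4 * rb ≤ infDist y 𝔇.Qcᶜ := hrb_q₅.trans (hq₅le y hy)
    have hwy := dist_le_of_mem_coreSqCl hw
    constructor
    · by_contra hni
      have hcl : w ∈ closure 𝔇.Qcᶜ := by rw [closure_compl]; exact hni
      have := infDist_le_dist_of_mem (x := y) hcl
      rw [infDist_closure, dist_comm] at this
      linarith
    · intro z hz
      have hzc : z ∈ closure 𝔇.Qcᶜ := by
        have h := hz; rw [frontier_eq_closure_inter_closure] at h; exact h.2
      have h1 := infDist_le_dist_of_mem (x := y) hzc
      rw [infDist_closure] at h1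
      have := dist_triangle y w z
      rw [dist_comm y w] at this
      linarith
  have smallsep : ∀ y ∈ Y, ∀ y' ∈ Y, y ≠ y' → ∀ w ∈ coreSqCl y rb, ∀ w' ∈ coreSqCl y' rb, 8 * rb ≤ dist w w' := by
    intro y hy y' hy' hne w hw w' hw'
    have h1 := hsepY y hy y' hy' hne
    have h2 := dist_le_of_mem_coreSqCl hw
    have h3 := dist_le_of_mem_coreSqCl hw'
    have := dist_triangle y w y'
    have := dist_triangle w w' y'
    rw [dist_comm] at h2
    linarith
  have mixsep : ∀ x ∈ JF, ∀ y ∈ Y, ∀ w ∈ coreSqCl x rB, ∀ w' ∈ coreSqCl y rb, 8 * rb ≤ dist w w' := by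
    intro x hx y hy w hw w' hw'
    have h1 : 10 * rb ≤ supDist y x - rB := hrb_q₄.trans (hq₄le (y, x) (Finset.mem_product.2 ⟨hy, hx⟩))
    have h2 := mem_coreSqCl_iff.1 hw
    have h3 := mem_coreSqCl_iff.1 hw'
    have h4 := supDist_triangle y w' w
    have h5 := supDist_triangle y w x
    have h6 := supDist_le_dist w' w
    rw [supDist_comm y w'] at h4
    rw [dist_comm] at h6
    linarith
  -- STEP 7: assemble
  set nB := JF.card with hnB
  set nb := Y.card with hnb
  set eJ : Fin nB ≃ JF := JF.equivFin.symm with heJ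
  set eY : Fin nb ≃ Y := Y.equivFin.symm with heY
  set ctr : Fin (nB + nb) → ℂ := Fin.append (fun i => (eJ i : ℂ)) (fun j => (eY j : ℂ)) with hctr
  set rad : Fin (nB + nb) → ℝ := Fin.append (fun _ : Fin nB => rB) (fun _ : Fin nb => rb) with hrad
  have ctr_big : ∀ i, ctr (Fin.castAdd nb i) = eJ i := fun i => by simp [hctr]
  have ctr_small : ∀ j, ctr (Fin.natAdd nB j) = eY j := fun j => by simp [hctr]
  have rad_big : ∀ i, rad (Fin.castAdd nb i) = rB := fun i => by simp [hrad]
  have rad_small : ∀ j, rad (Fin.natAdd nB j) = rb := fun j => by simp [hrad]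
  have eJ_mem : ∀ i, (eJ i : ℂ) ∈ JF := fun i => (eJ i).2
  have eY_mem : ∀ j, (eY j : ℂ) ∈ Y := fun j => (eY j).2
  -- every junction point / small centre is the centre of a square
  have big_of_mem : ∀ x ∈ JF, ∃ i, ctr (Fin.castAdd nb i) = x ∧ rad (Fin.castAdd nb i) = rB := fun x hx =>
    ⟨eJ.symm ⟨x, hx⟩, by rw [ctr_big, Equiv.apply_symm_apply], rad_big _⟩
  have small_of_mem : ∀ y ∈ Y, ∃ j, ctr (Fin.natAdd nB j) = y ∧ rad (Fin.natAdd nB j) = rb := fun y hy =>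
    ⟨eY.symm ⟨y, hy⟩, by rw [ctr_small, Equiv.apply_symm_apply], rad_small _⟩
  have core_of_J : ∀ z ∈ 𝔇.J, ∃ c, z ∈ coreSq (ctr c) (rad c) := fun z hz => by
    obtain ⟨i, hc, hr⟩ := big_of_mem z ((hJF_iff z).2 hz)
    exact ⟨_, by rw [hc, hr]; exact self_mem_coreSq hrB⟩
  set d₀ : ℝ := min dP rb with hd₀
  have hd₀pos : 0 < d₀ := lt_min hdP hrb
  have hd₀P : d₀ ≤ dP := min_le_left _ _
  have hd₀b : d₀ ≤ rb := min_le_right _ _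
  refine ⟨{
    nB := nB, nb := nb, ctr := ctr, rad := rad, rB := rB, rb := rb, η := η, d₀ := d₀, CUT := CUT
    rad_big := rad_big
    rad_small := rad_small
    rB_pos := hrB
    rB_le := hrB_FB
    rb_pos := hrb
    rb_le := hrb_fb
    rb_le_rB := by linarith
    η_pos := hηpos
    η_le := min_le_left _ _
    d₀_pos := hd₀pos
    ctr_mem := ?_
    sep := ?_
    kind := ?_
    bdry_sep := ?_
    good_far := ?_
    cut_bad := ?_
    cut_zero := hCUT0
    cut_one := hCUT1
    cut_mem := hCUTmem
    cut_var := hCUTvar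
    fin_frontier_K := ?_
    frontier_Q_core := fun k t _ hfr => core_of_J _ (mem_J_of_frontier (γe_mem_cut k t) hfr)
    multiple := fun k k' t t' ht ht' hne heq => core_of_J _ (mem_J_of_multiple ht ht' hne heq) }⟩
  · -- ctr_mem
    intro c
    induction c using Fin.addCases with
    | left i => rw [ctr_big]; exact hJcut _ (eJ_mem i)
    | right j => rw [ctr_small]; exact hYcut _ (eY_mem j)
  · -- sep
    intro c c' hcc'
    induction c using Fin.addCases with
    | left i =>
      induction c' using Fin.addCases with
      | left i' =>
        rw [ctr_big, ctr_big, rad_big, rad_big]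
        intro w hw w' hw'
        have hii' : (eJ i : ℂ) ≠ eJ i' := fun h => hcc' (by rw [eJ.injective (Subtype.ext h)])
        have := bigsep _ (eJ_mem i) _ (eJ_mem i') hii' w hw w' hw'
        linarith
      | right j' =>
        rw [ctr_big, ctr_small, rad_big, rad_small]
        exact mixsep _ (eJ_mem i) _ (eY_mem j')
    | right j =>
      induction c' using Fin.addCases with
      | left i' =>
        rw [ctr_big, ctr_small, rad_big, rad_small]
        intro w hw w' hw'
        rw [dist_comm]; exact mixsep _ (eJ_mem i') _ (eY_mem j) w' hw' w hw
      | right j' =>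
        rw [ctr_small, ctr_small, rad_small, rad_small]
        have hjj' : (eY j : ℂ) ≠ eY j' := fun h => hcc' (by rw [eY.injective (Subtype.ext h)])
        exact smallsep _ (eY_mem j) _ (eY_mem j') hjj'
  · -- kind
    intro c
    induction c using Fin.addCases with
    | left i =>
      by_cases hfr : (eJ i : ℂ) ∈ frontier 𝔇.Qc
      · exact Or.inr (Or.inr ⟨⟨i, rfl⟩, by rw [ctr_big]; exact hfr⟩)
      by_cases hQ : (eJ i : ℂ) ∈ 𝔇.Qc
      · refine Or.inl fun w hw => ?_
        rw [ctr_big, rad_big] at hw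
        obtain ⟨h1, h2⟩ := bigint _ (eJ_mem i) hfr hQ w hw
        exact ⟨h1, fun z hz => by have := h2 z hz; linarith⟩
      · refine Or.inr (Or.inl fun w hw => ?_)
        rw [ctr_big, rad_big] at hw
        obtain ⟨h1, h2⟩ := bigext _ (eJ_mem i) hfr hQ w hw
        exact ⟨h1, fun z hz => by have := h2 z hz; linarith⟩
    | right j =>
      refine Or.inl fun w hw => ?_
      rw [ctr_small, rad_small] at hw
      obtain ⟨h1, h2⟩ := smallint _ (eY_mem j) w hw
      exact ⟨h1, fun z hz => by have := h2 z hz; linarith⟩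
  · -- bdry_sep
    intro c hcfr z hz hz1 hz2 a ha ha1 ha2
    induction c using Fin.addCases with
    | left i =>
      rw [ctr_big] at hcfr hz1 hz2 ha1 ha2
      rw [rad_big] at hz1 hz2 ha1 ha2
      have h := hshell _ (eJ_mem i) z hz hz1 hz2 a ha ha1 ha2
      exact hη5.trans ((hmle _ (eJ_mem i)).trans h)
    | right j =>
      rw [ctr_small] at hcfr
      exact absurd hcfr (hYfr _ (eY_mem j))
  · -- good_far
    intro a ha hout z hz
    refine hd₀P.trans (hfarP a ha (fun x hx hax => ?_) z hz)
    obtain ⟨i, hc, hr⟩ := big_of_mem x hx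
    exact hout (Fin.castAdd nb i) (by rw [hc, hr]; exact hax)
  · -- cut_bad
    intro k t ht hQ
    by_cases h : ∃ x ∈ JF, 𝔇.γe k t ∈ coreSq x rB
    · obtain ⟨x, hx, hin⟩ := h
      obtain ⟨i, hc, hr⟩ := big_of_mem x hx
      exact ⟨Fin.castAdd nb i, by rw [hc, hr]; exact hin⟩
    · push Not at h
      have hy : 𝔇.γe k t ∈ Y := (hY_iff _).2 ⟨k, t, ht, hQ, h, rfl⟩
      obtain ⟨j, hc, hr⟩ := small_of_mem _ hy
      exact ⟨Fin.natAdd nB j, by rw [hc, hr]; exact self_mem_coreSq hrb⟩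
  · -- fin_frontier_K
    intro k c
    induction c using Fin.addCases with
    | left i =>
      rw [ctr_big, rad_big]
      refine (hlevB k _ (eJ_mem i)).subset fun t ht => ⟨ht.1, frontier_coreSq_subset _ _ ht.2⟩
    | right j =>
      rw [ctr_small, rad_small]
      refine (hlevb k _ (eY_mem j)).subset fun t ht => ⟨ht.1, frontier_coreSq_subset _ _ ht.2⟩

end CutData

end StripPieces

end Literature.Probability.Percolation

end
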